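import Literature.NumberTheory.LFunctions.SuzukiSingleOperatorKernelProofs
import Literature.NumberTheory.LFunctions.SuzukiSmallWindows

/-!
# SuzukiCleanRadius — a LINEAR clean-window radius for Suzuki's single operator `𝖪_θ[t]` (column DBR; RH-FREE)

RH-FREE throughout; nothing here bears on the truth of RH (a clean window certifies nothing about RH: the
residual `Theses.SuzukiWindowsDoor.AllWindowsWitness` asks for ONE `θ` with ALL windows clean, which is RH by
`Theorems.SuzukiWindowsDoorConverse.allWindows_iff_riemannHypothesis`).

Objects: Suzuki's single-operator kernel `K_θ = limKernel θ` ([Su20] = M. Suzuki, ASPM 84 (2020) = arXiv:1907.07302,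
(1.9); tree `Literature.NumberTheory.LFunctions.limKernel`) and the window predicate `NoUnitEigenvalue K t`
(`±1` is not an eigenvalue of `f ↦ ∫_{(−t,t)} K(· + y) f(y) dy` on `L²(−t,t)`).  [Su20] Thm 1.2 (K-v) gives, per
`θ > 1`, an INEXPLICIT `τ_θ > 0` with every window `t < τ_θ` clean (tree: `Suzuki2020_thm12_Kv`).

PROVED HERE (the banked RH-FREE targets of the cell's idea card `theta-semigroup-clean-radius`, rh-dbr 2026-08-26,
ENGINE-TARGETS.md §4.4; referee tautology test PASS):
* §1–§3 the HEIGHT BOUND `|K_θ(x)| ≤ ½ · exp(b x + A θ) · b^{1−θ}` for ALL `θ ≥ 2`, `b ≥ 3/2`, `x ∈ ℝ`, with ONE absolute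
  constant `A` (`exists_abs_limKernel_le_height`): move the inversion line to `Im z = b` (tree `invFourierLine_limTheta_eq`),
  bound the symbol there by `‖Θ_θ(u+ib)‖ ≤ e^{2θA₂} 2^θ (b² + u²)^{−θ/2}` from the tree's explicit-formula lower bound
  `Re ξ'/ξ(s) ≥ ½ log ‖s/2‖ − A₂` on `Re s ≥ 2` (`re_logDeriv_riemannXi_ge`), and integrate `∫ (b²+u²)^{−1} du = π/b`;
* §4 the LINEAR CLEAN RADIUS (`exists_linear_clean_radius`): there are `c > 0` and `θ₁` such that for every `θ ≥ θ₁`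
  EVERY window `0 ≤ t ≤ c·θ` is clean — the θ-UNIFORM, explicit-rate form of (K-v); from the height bound at the FIXED
  height `b = B := max(3/2, e^{A+2})` (so that `sup_{u < 2cθ} |K_θ(u)| ≤ ½ B e^{−θ}`, `c = 1/(2B)`) and the tree's
  small-window test `noUnitEigenvalue_of_small_window`;
* §5 the RH-FREE QUANTIFIER SWAP of the residual (`eventually_clean_each_window`): for every `T ≥ 0` all windows
  `t ≤ T` of `𝖪_θ` are clean for all large `θ`.
Data side (cell rh-dbr, ET1, certified): the Hilbert–Schmidt clean radii `t_HS(12) = 0.8268…`, `t_HS(20) = 1.2384…`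
grow linearly in `θ` (slope ≈ 0.06); this file proves the lower-bound LAW `τ_θ ≥ cθ` (with an unoptimised `c`).

References: [Su20] M. Suzuki, *Integral operators arising from the Riemann zeta function*, ASPM 84 (2020) 399–411,
Thm 1.2 (K-ii), (K-v); [Su21] M. Suzuki, J. Funct. Anal. 281 (2021) 109116, Prop. 4.2 (the small-operator mechanism).
-/

noncomputable section

-- D-0017: `Summit.<S>.<S>.…` is the designed namespace of a single-problem summit.
set_option linter.dupNamespace false

open Complex MeasureTheory Filter Topology Set
open scoped Real

namespace Summit.RiemannHypothesis.RiemannHypothesis.Theorems.SuzukiCleanRadius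

open Literature.NumberTheory.LFunctions

/-! ## §1 The symbol on high lines: `‖Θ_θ(u + ib)‖ ≤ e^{2θA₂} · 2^θ · (b² + u²)^{−θ/2}` for `b ≥ 3/2`, `θ ≥ 0` -/

/-- `Re(½ − i(u + ib)) = ½ + b`. -/
private theorem re_half_sub_I_mul_line (u b : ℝ) :
    ((1 : ℂ) / 2 - I * ((u : ℂ) + (b : ℂ) * I)).re = 1 / 2 + b := by
  simp only [Complex.sub_re, Complex.div_ofNat_re, Complex.one_re, Complex.mul_re, Complex.mul_im,
    Complex.I_re, Complex.I_im, Complex.add_re, Complex.add_im, Complex.ofReal_re, Complex.ofReal_im]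
  ring

/-- `Im(½ − i(u + ib)) = −u`. -/
private theorem im_half_sub_I_mul_line (u b : ℝ) :
    ((1 : ℂ) / 2 - I * ((u : ℂ) + (b : ℂ) * I)).im = -u := by
  simp only [Complex.sub_im, Complex.div_ofNat_im, Complex.one_im, Complex.mul_re, Complex.mul_im,
    Complex.I_re, Complex.I_im, Complex.add_re, Complex.add_im, Complex.ofReal_re, Complex.ofReal_im]
  ring

/-- On the line `Im z = b > 0`: `½ log(b² + u²) ≤ log ‖½ − i(u+ib)‖` (as `b² + u² ≤ (½ + b)² + u² = ‖s‖²`). -/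
private theorem half_log_sq_add_sq_le_log_norm {u b : ℝ} (hb : 0 < b) :
    1 / 2 * Real.log (b ^ 2 + u ^ 2) ≤ Real.log ‖(1 : ℂ) / 2 - I * ((u : ℂ) + (b : ℂ) * I)‖ := by
  set s := (1 : ℂ) / 2 - I * ((u : ℂ) + (b : ℂ) * I) with hs
  have hre := re_half_sub_I_mul_line u b
  have him := im_half_sub_I_mul_line u b
  rw [← hs] at hre him
  have hq : 0 < b ^ 2 + u ^ 2 := by positivity
  have hsq : ‖s‖ ^ 2 = (1 / 2 + b) ^ 2 + u ^ 2 := by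
    rw [Complex.sq_norm, Complex.normSq_apply, hre, him]; ring
  have hle : b ^ 2 + u ^ 2 ≤ ‖s‖ ^ 2 := by rw [hsq]; nlinarith
  have hnorm : 0 < ‖s‖ := by
    rcases (norm_nonneg s).lt_or_eq with h | h
    · exact h
    · exfalso; rw [← h] at hle; nlinarith
  have h1 : Real.log (b ^ 2 + u ^ 2) ≤ Real.log (‖s‖ ^ 2) := Real.log_le_log hq hle
  rw [Real.log_pow] at h1
  push_cast at h1
  linarith

open LSeries in
open scoped LSeries.notation ArithmeticFunction.vonMangoldt in
/-- **Symbol bound on high lines** (RH-free): for `θ ≥ 0`, `b ≥ 3/2` and real `u`,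
`‖Θ_θ(u + ib)‖ ≤ exp(2θA₂) · 2^θ · (b² + u²)^{−θ/2}` with `A₂ = 5/2 + Σ Λ(n) n^{−2}` — from
`‖Θ_θ‖ = exp(−2θ Re ξ'/ξ(s))`, `s = ½ + b − iu`, and the tree's `Re ξ'/ξ(s) ≥ ½ log ‖s/2‖ − A₂` on `Re s ≥ 2`. -/
theorem norm_limTheta_line_le_height {θ : ℝ} (hθ : 0 ≤ θ) {b : ℝ} (hb : 3 / 2 ≤ b) (u : ℝ) :
    ‖limTheta θ ((u : ℂ) + (b : ℂ) * I)‖ ≤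
      Real.exp (2 * θ * (5 / 2 + ∑' n : ℕ, ‖term ↗Λ ((2 : ℝ) : ℂ) n‖)) * (2 : ℝ) ^ θ *
        (b ^ 2 + u ^ 2) ^ (-(θ / 2)) := by
  set A : ℝ := 5 / 2 + ∑' n : ℕ, ‖term ↗Λ ((2 : ℝ) : ℂ) n‖ with hA
  set s := (1 : ℂ) / 2 - I * ((u : ℂ) + (b : ℂ) * I) with hs
  have hb0 : 0 < b := by linarith
  have hsre : (2 : ℝ) ≤ s.re := by rw [hs, re_half_sub_I_mul_line]; linarith
  have hlow := re_logDeriv_riemannXi_ge (σ₀ := 2) one_lt_two (s := s) (by exact_mod_cast hsre)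
  rw [← hA] at hlow
  have hq : 0 < b ^ 2 + u ^ 2 := by positivity
  have hlogs := half_log_sq_add_sq_le_log_norm (u := u) hb0
  rw [← hs] at hlogs
  have hnorm : 0 < ‖s‖ := by
    have : 0 < s.re := by linarith
    exact lt_of_lt_of_le this (Complex.re_le_norm s)
  have hlog2 : Real.log ‖s / 2‖ = Real.log ‖s‖ - Real.log 2 := by
    rw [norm_div, Complex.norm_two, Real.log_div hnorm.ne' two_ne_zero]
  rw [norm_limTheta, ← hs]
  -- exponent comparison
  have step : -2 * θ * (logDeriv riemannXi s).re ≤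
      2 * θ * A + θ * Real.log 2 + (-(θ / 2)) * Real.log (b ^ 2 + u ^ 2) := by
    have h1 := mul_le_mul_of_nonneg_left hlow (by linarith : 0 ≤ 2 * θ)
    rw [hlog2] at h1
    have h2 := mul_le_mul_of_nonneg_left hlogs hθ
    nlinarith
  calc Real.exp (-2 * θ * (logDeriv riemannXi s).re)
      ≤ Real.exp (2 * θ * A + θ * Real.log 2 + (-(θ / 2)) * Real.log (b ^ 2 + u ^ 2)) :=
        Real.exp_le_exp.2 step
    _ = Real.exp (2 * θ * A) * (2 : ℝ) ^ θ * (b ^ 2 + u ^ 2) ^ (-(θ / 2)) := by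
        rw [Real.exp_add, Real.exp_add, Real.rpow_def_of_pos two_pos, Real.rpow_def_of_pos hq,
          mul_comm (Real.log 2) θ, mul_comm (Real.log (b ^ 2 + u ^ 2))]

/-! ## §2 Two real-variable integrals -/

/-- `∫_ℝ (b² + u²)⁻¹ du = π / b` for `b > 0` (substitution `u = b v` in `∫ (1 + v²)⁻¹ = π`). -/
theorem integral_inv_sq_add_sq {b : ℝ} (hb : 0 < b) : ∫ u : ℝ, (b ^ 2 + u ^ 2)⁻¹ = π / b := by
  have h : (fun u : ℝ => (b ^ 2 + u ^ 2)⁻¹) = fun u : ℝ => (b ^ 2)⁻¹ * (1 + (b⁻¹ * u) ^ 2)⁻¹ := by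
    funext u
    have hb2 : b ^ 2 ≠ 0 := by positivity
    field_simp
  rw [h, integral_const_mul, Measure.integral_comp_mul_left (fun y : ℝ => (1 + y ^ 2)⁻¹) b⁻¹,
    inv_inv, abs_of_pos hb, integral_univ_inv_one_add_sq, smul_eq_mul]
  field_simp

/-- `u ↦ (b² + u²)⁻¹` is integrable on `ℝ` for `b > 0`. -/
theorem integrable_inv_sq_add_sq {b : ℝ} (hb : 0 < b) : Integrable fun u : ℝ => (b ^ 2 + u ^ 2)⁻¹ := by
  have h : (fun u : ℝ => (b ^ 2 + u ^ 2)⁻¹) = fun u : ℝ => (b ^ 2)⁻¹ * (1 + (b⁻¹ * u) ^ 2)⁻¹ := by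
    funext u
    have hb2 : b ^ 2 ≠ 0 := by positivity
    field_simp
  rw [h]
  exact (integrable_inv_one_add_sq.comp_mul_left' (inv_ne_zero hb.ne')).const_mul _

/-- For `θ ≥ 2`, `b > 0`: `(b² + u²)^{−θ/2} ≤ b^{2−θ} · (b² + u²)⁻¹`. -/
theorem rpow_neg_half_le {θ : ℝ} (hθ : 2 ≤ θ) {b : ℝ} (hb : 0 < b) (u : ℝ) :
    (b ^ 2 + u ^ 2) ^ (-(θ / 2)) ≤ b ^ (2 - θ) * (b ^ 2 + u ^ 2)⁻¹ := by
  have hq : 0 < b ^ 2 + u ^ 2 := by positivity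
  have hsplit : (b ^ 2 + u ^ 2) ^ (-(θ / 2)) = (b ^ 2 + u ^ 2) ^ (1 - θ / 2) * (b ^ 2 + u ^ 2)⁻¹ := by
    rw [show -(θ / 2) = (1 - θ / 2) + (-1 : ℝ) by ring, Real.rpow_add hq, Real.rpow_neg_one]
  rw [hsplit]
  refine mul_le_mul_of_nonneg_right ?_ (inv_nonneg.2 hq.le)
  have h1 : (b ^ 2 + u ^ 2) ^ (1 - θ / 2) ≤ (b ^ 2) ^ (1 - θ / 2) :=
    Real.rpow_le_rpow_of_nonpos (by positivity) (by nlinarith) (by linarith)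
  have h2 : (b ^ 2 : ℝ) ^ (1 - θ / 2) = b ^ (2 - θ) := by
    rw [show (b ^ 2 : ℝ) = b ^ (2 : ℝ) by norm_cast, ← Real.rpow_mul hb.le]
    congr 1; ring
  rw [← h2]; exact h1

open LSeries in
open scoped LSeries.notation ArithmeticFunction.vonMangoldt in
/-- **The symbol's `L¹`-mass on high lines** (RH-free): for `θ ≥ 2` and `b ≥ 3/2`,
`∫ ‖Θ_θ(u + ib)‖ du ≤ π · exp(2θA₂) · 2^θ · b^{1−θ}`. -/
theorem integral_norm_limTheta_line_le_height {θ : ℝ} (hθ : 2 ≤ θ) {b : ℝ} (hb : 3 / 2 ≤ b) :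
    ∫ u : ℝ, ‖limTheta θ ((u : ℂ) + (b : ℂ) * I)‖ ≤
      π * Real.exp (2 * θ * (5 / 2 + ∑' n : ℕ, ‖term ↗Λ ((2 : ℝ) : ℂ) n‖)) * (2 : ℝ) ^ θ * b ^ (1 - θ) := by
  set A : ℝ := 5 / 2 + ∑' n : ℕ, ‖term ↗Λ ((2 : ℝ) : ℂ) n‖ with hA
  have hb0 : 0 < b := by linarith
  set C : ℝ := Real.exp (2 * θ * A) * (2 : ℝ) ^ θ * b ^ (2 - θ) with hC
  have hC0 : 0 ≤ C := by positivity
  have hpt : ∀ u : ℝ, ‖limTheta θ ((u : ℂ) + (b : ℂ) * I)‖ ≤ C * (b ^ 2 + u ^ 2)⁻¹ := by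
    intro u
    have h1 := norm_limTheta_line_le_height (θ := θ) (by linarith) hb u
    rw [← hA] at h1
    have h2 := rpow_neg_half_le hθ hb0 u
    calc ‖limTheta θ ((u : ℂ) + (b : ℂ) * I)‖
        ≤ Real.exp (2 * θ * A) * (2 : ℝ) ^ θ * (b ^ 2 + u ^ 2) ^ (-(θ / 2)) := h1
      _ ≤ Real.exp (2 * θ * A) * (2 : ℝ) ^ θ * (b ^ (2 - θ) * (b ^ 2 + u ^ 2)⁻¹) :=
          mul_le_mul_of_nonneg_left h2 (by positivity)
      _ = C * (b ^ 2 + u ^ 2)⁻¹ := by rw [hC]; ring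
  have hint := integrable_inv_sq_add_sq hb0
  calc ∫ u : ℝ, ‖limTheta θ ((u : ℂ) + (b : ℂ) * I)‖
      ≤ ∫ u : ℝ, C * (b ^ 2 + u ^ 2)⁻¹ :=
        integral_mono_of_nonneg (Eventually.of_forall fun u => norm_nonneg _) (hint.const_mul C)
          (Eventually.of_forall hpt)
    _ = C * (π / b) := by rw [integral_const_mul, integral_inv_sq_add_sq hb0]
    _ = π * Real.exp (2 * θ * A) * (2 : ℝ) ^ θ * b ^ (1 - θ) := by
        have hb1 : b ^ (1 - θ) = b ^ (2 - θ) * b⁻¹ := by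
          rw [show (1 - θ : ℝ) = (2 - θ) + (-1 : ℝ) by ring, Real.rpow_add hb0, Real.rpow_neg_one]
        rw [hC, hb1]
        field_simp

/-! ## §3 The height bound for `K_θ` -/

open LSeries in
open scoped LSeries.notation ArithmeticFunction.vonMangoldt in
/-- **Height bound, explicit constant** (RH-free): for `θ ≥ 2`, `b ≥ 3/2` and every real `x`,
`|K_θ(x)| ≤ ½ · exp(b x + (2A₂ + log 2) θ) · b^{1−θ}`, `A₂ = 5/2 + Σ Λ(n) n^{−2}`: line independence
(`K_θ(x) = Re invFourierLine Θ_θ b x`), `‖invFourierLine Φ b x‖ ≤ (2π)⁻¹ e^{bx} ∫ ‖Φ(u+ib)‖ du`, and §2. -/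
theorem abs_limKernel_le_height {θ : ℝ} (hθ : 2 ≤ θ) {b : ℝ} (hb : 3 / 2 ≤ b) (x : ℝ) :
    |limKernel θ x| ≤ 1 / 2 * Real.exp (b * x + (2 * (5 / 2 + ∑' n : ℕ, ‖term ↗Λ ((2 : ℝ) : ℂ) n‖) + Real.log 2) * θ) *
      b ^ (1 - θ) := by
  set A : ℝ := 5 / 2 + ∑' n : ℕ, ‖term ↗Λ ((2 : ℝ) : ℂ) n‖ with hA
  have hθ1 : 1 < θ := by linarith
  have hb' : 1 / 2 < b := by linarith
  have hb0 : 0 < b := by linarith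
  have hmass := integral_norm_limTheta_line_le_height hθ hb
  rw [← hA] at hmass
  have hexp : Real.exp (b * x + (2 * A + Real.log 2) * θ) = Real.exp (b * x) * (Real.exp (2 * θ * A) * (2 : ℝ) ^ θ) := by
    rw [Real.rpow_def_of_pos two_pos, ← Real.exp_add, ← Real.exp_add]
    congr 1; ring
  calc |limKernel θ x| = |(invFourierLine (limTheta θ) 1 x).re| := rfl
    _ ≤ ‖invFourierLine (limTheta θ) 1 x‖ := Complex.abs_re_le_norm _
    _ = ‖invFourierLine (limTheta θ) b x‖ := by rw [invFourierLine_limTheta_eq hθ1 (by norm_num) hb']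
    _ ≤ 1 / (2 * Real.pi) * Real.exp (b * x) * ∫ u : ℝ, ‖limTheta θ ((u : ℂ) + (b : ℂ) * I)‖ :=
        norm_invFourierLine_le _ _ _
    _ ≤ 1 / (2 * Real.pi) * Real.exp (b * x) * (π * Real.exp (2 * θ * A) * (2 : ℝ) ^ θ * b ^ (1 - θ)) :=
        mul_le_mul_of_nonneg_left hmass (by positivity)
    _ = 1 / 2 * Real.exp (b * x + (2 * A + Real.log 2) * θ) * b ^ (1 - θ) := by
        rw [hexp]
        field_simp

/-- **HEIGHT BOUND** (RH-FREE; the card's `HeightOptimisedBound` with `C = ½`): there is an absolute constant `A` with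
`|K_θ(x)| ≤ ½ · exp(b x + A θ) · b^{1−θ}` for all `θ ≥ 2`, all `b ≥ 3/2` and all real `x`.  (Optimising `b` in `x`
gives `Γ(θ)`-type smallness of `K_θ` on windows `x ≤ cθ`; §4 uses one fixed `b`.) -/
theorem exists_abs_limKernel_le_height : ∃ A : ℝ, ∀ θ : ℝ, 2 ≤ θ → ∀ b : ℝ, 3 / 2 ≤ b → ∀ x : ℝ,
    |limKernel θ x| ≤ 1 / 2 * Real.exp (b * x + A * θ) * b ^ (1 - θ) :=
  ⟨_, fun _ hθ _ hb x => abs_limKernel_le_height hθ hb x⟩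

/-! ## §4 The linear clean radius -/

/-- From a height bound with constant `A`: at the FIXED height `B = max(3/2, e^{A+2})`, for `θ ≥ 2` and every `u < θ/B`,
`|K_θ(u)| ≤ ½ · B · e^{−θ}`. -/
theorem abs_limKernel_le_of_lt_window {A θ u : ℝ}
    (hA : ∀ θ : ℝ, 2 ≤ θ → ∀ b : ℝ, 3 / 2 ≤ b → ∀ x : ℝ,
      |limKernel θ x| ≤ 1 / 2 * Real.exp (b * x + A * θ) * b ^ (1 - θ))
    (hθ : 2 ≤ θ) (hu : u < θ / max (3 / 2) (Real.exp (A + 2))) :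
    |limKernel θ u| ≤ 1 / 2 * max (3 / 2) (Real.exp (A + 2)) * Real.exp (-θ) := by
  set B : ℝ := max (3 / 2) (Real.exp (A + 2)) with hB
  have hB32 : 3 / 2 ≤ B := le_max_left _ _
  have hB0 : 0 < B := by linarith
  have hBlog : A + 2 ≤ Real.log B := by
    rw [← Real.log_exp (A + 2)]
    exact Real.log_le_log (Real.exp_pos _) (le_max_right _ _)
  have h1 := hA θ hθ B hB32 u
  have hBu : B * u ≤ θ := by
    have := mul_le_mul_of_nonneg_left hu.le hB0.le
    rwa [mul_div_cancel₀ _ hB0.ne'] at this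
  have hpow : B ^ (1 - θ) = Real.exp ((1 - θ) * Real.log B) := by
    rw [Real.rpow_def_of_pos hB0, mul_comm]
  have hexp : 1 / 2 * Real.exp (B * u + A * θ) * B ^ (1 - θ) ≤ 1 / 2 * B * Real.exp (-θ) := by
    rw [hpow, mul_assoc, ← Real.exp_add]
    have hB' : B = Real.exp (Real.log B) := (Real.exp_log hB0).symm
    have key : B * u + A * θ + (1 - θ) * Real.log B ≤ Real.log B + -θ := by
      have hθ0 : 0 ≤ θ := by linarith
      nlinarith [mul_le_mul_of_nonneg_left hBlog hθ0]
    calc 1 / 2 * Real.exp (B * u + A * θ + (1 - θ) * Real.log B)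
        ≤ 1 / 2 * Real.exp (Real.log B + -θ) :=
          mul_le_mul_of_nonneg_left (Real.exp_le_exp.2 key) (by norm_num)
      _ = 1 / 2 * B * Real.exp (-θ) := by rw [Real.exp_add, Real.exp_log hB0]; ring
  exact h1.trans hexp

/-- **LINEAR CLEAN RADIUS** (RH-FREE; the card's `LinearCleanRadius`): there are `c > 0` and `θ₁` such that for
every `θ ≥ θ₁` and every window `0 ≤ t ≤ c·θ`, `±1` is not an eigenvalue of `𝖪_θ[t]` on `L²(−t,t)`
(`NoUnitEigenvalue (limKernel θ) t`).  Proof: with the height bound's `A`, take `B = max(3/2, e^{A+2})`,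
`c = 1/(2B)`, `θ₁ = 2`; on `|u| < 2t ≤ θ/B` one has `|K_θ(u)| ≤ ½ B e^{−θ}` and `2t · ½ B e^{−θ} ≤ ½ θ e^{−θ} < 1`,
so the small-window test `noUnitEigenvalue_of_small_window` applies.  This is the θ-uniform, explicit-rate form of
[Su20] Thm 1.2 (K-v) (there: some inexplicit `τ_θ > 0` per `θ`). -/
theorem exists_linear_clean_radius : ∃ c : ℝ, 0 < c ∧ ∃ θ₁ : ℝ, ∀ θ : ℝ, θ₁ ≤ θ →
    ∀ t : ℝ, 0 ≤ t → t ≤ c * θ → NoUnitEigenvalue (limKernel θ) t := by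
  obtain ⟨A, hA⟩ := exists_abs_limKernel_le_height
  set B : ℝ := max (3 / 2) (Real.exp (A + 2)) with hB
  have hB0 : 0 < B := lt_of_lt_of_le (by norm_num) (le_max_left _ _)
  refine ⟨1 / (2 * B), by positivity, 2, fun θ hθ t ht0 htc => ?_⟩
  have hθ0 : 0 ≤ θ := by linarith
  have htc' : 2 * t ≤ θ / B := by
    have := mul_le_mul_of_nonneg_left htc (by norm_num : (0 : ℝ) ≤ 2)
    calc 2 * t ≤ 2 * (1 / (2 * B) * θ) := this
      _ = θ / B := by field_simp
  refine noUnitEigenvalue_of_small_window (M := 1 / 2 * B * Real.exp (-θ)) (fun u hu => ?_) ?_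
  · have hu' : u < θ / B := lt_of_lt_of_le (abs_lt.1 hu).2 htc'
    have := abs_limKernel_le_of_lt_window (A := A) hA hθ hu'
    rwa [← hB] at this
  · -- `2t · ½ B e^{−θ} ≤ ½ θ e^{−θ} < 1`
    have h1 : 2 * t * (1 / 2 * B * Real.exp (-θ)) ≤ θ / B * (1 / 2 * B * Real.exp (-θ)) :=
      mul_le_mul_of_nonneg_right htc' (by positivity)
    have h2 : θ / B * (1 / 2 * B * Real.exp (-θ)) = 1 / 2 * (θ * Real.exp (-θ)) := by
      field_simp
    have h3 : θ * Real.exp (-θ) < 1 := by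
      have hlt : θ < Real.exp θ := by
        have := Real.add_one_le_exp θ
        linarith
      rw [Real.exp_neg]
      have hpos := Real.exp_pos θ
      rw [mul_inv_lt_iff₀ hpos]
      linarith
    linarith

/-! ## §5 The RH-free quantifier swap of the residual -/

/-- **EVENTUAL CLEANLINESS OF EACH WINDOW** (RH-FREE; the card's `EventuallyCleanEachWindow`): for every `T ≥ 0` there
is `θ₀` such that for all `θ ≥ θ₀` every window `0 ≤ t ≤ T` of `𝖪_θ` carries no eigenvalue `±1`.  This is the
quantifier swap `∀ T ∃ θ₀ ∀ θ ≥ θ₀` of the residual `AllWindowsWitness` (`∃ θ ∀ t`), and says nothing about it. -/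
theorem eventually_clean_each_window : ∀ T : ℝ, 0 ≤ T → ∃ θ₀ : ℝ, ∀ θ : ℝ, θ₀ ≤ θ →
    ∀ t : ℝ, 0 ≤ t → t ≤ T → NoUnitEigenvalue (limKernel θ) t := by
  obtain ⟨c, hc, θ₁, h⟩ := exists_linear_clean_radius
  intro T _hT
  refine ⟨max θ₁ (T / c), fun θ hθ t ht0 htT => h θ (le_trans (le_max_left _ _) hθ) t ht0 ?_⟩
  have hθ' : T / c ≤ θ := le_trans (le_max_right _ _) hθ
  have : T ≤ c * θ := by
    calc T = c * (T / c) := by field_simp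
      _ ≤ c * θ := mul_le_mul_of_nonneg_left hθ' hc.le
  linarith

end Summit.RiemannHypothesis.RiemannHypothesis.Theorems.SuzukiCleanRadius

end
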